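import Mathlib.MeasureTheory.Integral.Layercake
import Mathlib.Analysis.SpecialFunctions.Log.Basic
import Literature.Probability.Divergences.KLDivConvexity
import Literature.MathematicalPhysics.KineticTheory.RegularStationaryState

/-!
# Entropy bound for tangent states, IV: lower semicontinuity of the Kullback–Leibler divergence (line `FirstLemma`, crux stmt-AtomisticToContinuum-14135)

Helper file (Core of step (L)) of the registered stub `stub_tangentEntropyBoundUniform : TangentEntropyBoundUniform`
(`…KiferEntropyBoundAffinity.lean`), namespace `Summit.AtomisticToContinuum.HydrodynamicLimit.Theorems.KiferCompactification`.
The unit-weight entropy bound "`H(Q_N | G_N) ≤ C N` passes to local-equilibrium limit points with constant `1`" needs,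
window by window, the LOWER SEMICONTINUITY of `KL(· ‖ ·)` along `(P_k)_Λ → μ_Λ` (weakly, on a class of bounded test
functionals only: Laplace functionals of the blow-ups converge) and `(Γ_k)_Λ → G_Λ` (setwise). This file proves that
step ABSTRACTLY, on a general measurable space, from the two halves of the Donsker–Varadhan variational formula in the
tree (`Literature.Probability.Divergences.integral_le_toReal_klDiv_add_log`, `klDiv_le_of_forall_integral_le`):

* `integral_le_toReal_liminf_klDiv_add_log` — the Gibbs inequality survives the limit for ONE bounded test function
  `ψ` along which `∫ ψ dP_k → ∫ ψ dμ` and `∫ e^ψ dR_k → ∫ e^ψ dν`: `∫ ψ dμ ≤ liminf_k KL(P_k ‖ R_k) + log ∫ e^ψ dν`;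
* `klDiv_le_ofReal_of_forall_mem` — the Donsker–Varadhan upper bound needs the Gibbs inequality only on a class `𝓥` of
  bounded test functions which is DENSE in `L¹(μ) ∩ L¹(ν)` among bounded measurable functions with the same bound;
* `stub_klDiv_lsc_of_denseClass` (REGISTERED helper stub) — joint lower semicontinuity
  `KL(μ ‖ ν) ≤ liminf_k KL(P_k ‖ R_k)` when `P_k → μ` on `𝓥`, `∫ e^ψ dR_k → ∫ e^ψ dν` on `𝓥`, and `𝓥` is dense as above;
* `tendsto_integral_of_forall_tendsto_measure` — setwise convergence of probability laws gives convergence of the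
  integrals of bounded measurable functions (layer-cake formula + dominated convergence), so a setwise convergent
  reference qualifies; `klDiv_lsc_of_denseClass_of_setwise` — the combination;
* `klDiv_map_le_klDiv` — the data-processing inequality for push-forwards (again from the two DV halves), and its window
  form `klDiv_windowLaw_mono`: `KL(μ_Λ ‖ G_Λ) ≤ KL(μ_Λ' ‖ G_Λ')` for `Λ ⊆ Λ'` (entropy of a sub-window is smaller), used to
  replace the half-open cubes of `specificRelEntropy` by open windows.

No new definitions; no topology is put on the measurable space (the test class is a parameter).
References: Donsker–Varadhan 1975; Kipnis–Landim 1999, App. 1 §8; Dupuis–Ellis 1997, Lemma 1.4.3 (b)–(c).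
-/

noncomputable section

open MeasureTheory Set Filter Topology InformationTheory
open scoped ENNReal

namespace Summit.AtomisticToContinuum.HydrodynamicLimit.Theorems.KiferCompactification

open Literature.Probability.Divergences (integral_le_toReal_klDiv_add_log klDiv_le_of_forall_integral_le)

variable {Ω : Type*} [MeasurableSpace Ω]

/-! ## Bounded test functions: integrability bookkeeping -/

/-- A measurable function bounded by `C` is integrable under a finite measure. -/
private theorem integrable_of_abs_le' (μ : Measure Ω) [IsFiniteMeasure μ] {ψ : Ω → ℝ} (hψ : Measurable ψ)
    {C : ℝ} (hC : ∀ x, |ψ x| ≤ C) : Integrable ψ μ :=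
  Integrable.of_bound hψ.aestronglyMeasurable C (ae_of_all _ fun x => by rw [Real.norm_eq_abs]; exact hC x)

/-- The exponential of a measurable function bounded by `C` is integrable under a finite measure. -/
private theorem integrable_exp_of_abs_le (μ : Measure Ω) [IsFiniteMeasure μ] {ψ : Ω → ℝ} (hψ : Measurable ψ)
    {C : ℝ} (hC : ∀ x, |ψ x| ≤ C) : Integrable (fun x => Real.exp (ψ x)) μ :=
  Integrable.of_bound hψ.exp.aestronglyMeasurable (Real.exp C) (ae_of_all _ fun x => by
    rw [Real.norm_eq_abs, abs_of_pos (Real.exp_pos _)]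
    exact Real.exp_le_exp.2 ((le_abs_self _).trans (hC x)))

/-- The exponential moment of a bounded measurable function under a probability law is positive. -/
private theorem integral_exp_pos_of_abs_le (μ : Measure Ω) [IsProbabilityMeasure μ] {ψ : Ω → ℝ}
    (hψ : Measurable ψ) {C : ℝ} (hC : ∀ x, |ψ x| ≤ C) : 0 < ∫ x, Real.exp (ψ x) ∂μ :=
  integral_exp_pos (integrable_exp_of_abs_le μ hψ hC)

/-- `L¹`-closeness of bounded functions controls their means: `∫ ψ dμ ≤ ∫ ψ' dμ + ∫ |ψ - ψ'| dμ`. -/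
private theorem integral_le_integral_add_integral_abs_sub (μ : Measure Ω) [IsFiniteMeasure μ] {ψ ψ' : Ω → ℝ}
    (hψ : Measurable ψ) (hψ' : Measurable ψ') {C : ℝ} (hC : ∀ x, |ψ x| ≤ C) (hC' : ∀ x, |ψ' x| ≤ C) :
    ∫ x, ψ x ∂μ ≤ ∫ x, ψ' x ∂μ + ∫ x, |ψ x - ψ' x| ∂μ := by
  have hdi : Integrable (fun x => |ψ x - ψ' x|) μ :=
    ((integrable_of_abs_le' μ hψ hC).sub (integrable_of_abs_le' μ hψ' hC')).abs
  rw [← integral_add (integrable_of_abs_le' μ hψ' hC') hdi]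
  exact integral_mono (integrable_of_abs_le' μ hψ hC) ((integrable_of_abs_le' μ hψ' hC').add hdi)
    fun x => by have := le_abs_self (ψ x - ψ' x); dsimp only; linarith

/-- `L¹`-closeness of functions bounded by `C` controls their exponential moments:
`∫ e^{ψ'} dν ≤ ∫ e^ψ dν + e^C ∫ |ψ - ψ'| dν` (`exp` is `e^C`-Lipschitz on `[-C, C]`). -/
private theorem integral_exp_le_integral_exp_add (ν : Measure Ω) [IsFiniteMeasure ν] {ψ ψ' : Ω → ℝ}
    (hψ : Measurable ψ) (hψ' : Measurable ψ') {C : ℝ} (hC : ∀ x, |ψ x| ≤ C) (hC' : ∀ x, |ψ' x| ≤ C) :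
    ∫ x, Real.exp (ψ' x) ∂ν ≤ ∫ x, Real.exp (ψ x) ∂ν + Real.exp C * ∫ x, |ψ x - ψ' x| ∂ν := by
  have hdi : Integrable (fun x => |ψ x - ψ' x|) ν :=
    ((integrable_of_abs_le' ν hψ hC).sub (integrable_of_abs_le' ν hψ' hC')).abs
  rw [← integral_const_mul, ← integral_add (integrable_exp_of_abs_le ν hψ hC) (hdi.const_mul _)]
  refine integral_mono (integrable_exp_of_abs_le ν hψ' hC')
    ((integrable_exp_of_abs_le ν hψ hC).add (hdi.const_mul _)) fun x => ?_
  dsimp only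
  -- mean value bound for `exp` on `[-C, C]`
  have hx : ψ x ∈ Icc (-C) C := abs_le.1 (hC x)
  have hx' : ψ' x ∈ Icc (-C) C := abs_le.1 (hC' x)
  have hlip : ∀ a ∈ Icc (-C) C, ∀ b ∈ Icc (-C) C, Real.exp b - Real.exp a ≤ Real.exp C * |a - b| := by
    intro a ha b hb
    rcases le_total a b with hab | hab
    · -- `e^b - e^a ≤ e^b (b - a) ≤ e^C |a - b|`
      have h1 : Real.exp b - Real.exp a ≤ Real.exp b * (b - a) := by
        have := Real.add_one_le_exp (a - b)
        have hexp : Real.exp (a - b) = Real.exp a / Real.exp b := Real.exp_sub a b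
        rw [hexp, le_div_iff₀ (Real.exp_pos b)] at this
        nlinarith [Real.exp_pos b]
      calc Real.exp b - Real.exp a ≤ Real.exp b * (b - a) := h1
        _ ≤ Real.exp C * |a - b| := by
            rw [abs_sub_comm, abs_of_nonneg (sub_nonneg.2 hab)]
            exact mul_le_mul_of_nonneg_right (Real.exp_le_exp.2 hb.2) (sub_nonneg.2 hab)
    · calc Real.exp b - Real.exp a ≤ 0 := sub_nonpos.2 (Real.exp_le_exp.2 hab)
        _ ≤ Real.exp C * |a - b| := mul_nonneg (Real.exp_pos C).le (abs_nonneg _)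
  linarith [hlip (ψ x) hx (ψ' x) hx']

/-! ## The Gibbs inequality survives the limit along one test function -/

/-- **The Gibbs / Donsker–Varadhan inequality passes to the limit along one test function.** Let `P_k, R_k` be
probability laws, `ψ` a measurable function with `|ψ| ≤ C`, and suppose `∫ ψ dP_k → ∫ ψ dμ` and
`∫ e^ψ dR_k → ∫ e^ψ dν` (`ν` a probability law). If `liminf_k KL(P_k ‖ R_k) < ∞` then
`∫ ψ dμ ≤ liminf_k KL(P_k ‖ R_k) + log ∫ e^ψ dν`. (Frequently `KL(P_k ‖ R_k) < liminf + δ`; there the finite-`k`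
Gibbs inequality `∫ ψ dP_k ≤ KL(P_k ‖ R_k) + log ∫ e^ψ dR_k` holds, and both sides converge.) -/
theorem integral_le_toReal_liminf_klDiv_add_log {P R : ℕ → Measure Ω} [∀ k, IsProbabilityMeasure (P k)]
    [∀ k, IsProbabilityMeasure (R k)] {μ ν : Measure Ω} [IsProbabilityMeasure ν] {ψ : Ω → ℝ} {C : ℝ}
    (hψ : Measurable ψ) (hC : ∀ x, |ψ x| ≤ C)
    (hP : Tendsto (fun k => ∫ x, ψ x ∂(P k)) atTop (𝓝 (∫ x, ψ x ∂μ)))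
    (hR : Tendsto (fun k => ∫ x, Real.exp (ψ x) ∂(R k)) atTop (𝓝 (∫ x, Real.exp (ψ x) ∂ν)))
    (hL : liminf (fun k => klDiv (P k) (R k)) atTop ≠ ∞) :
    ∫ x, ψ x ∂μ ≤ (liminf (fun k => klDiv (P k) (R k)) atTop).toReal + Real.log (∫ x, Real.exp (ψ x) ∂ν) := by
  set L := liminf (fun k => klDiv (P k) (R k)) atTop with hLdef
  have hZ : 0 < ∫ x, Real.exp (ψ x) ∂ν := integral_exp_pos_of_abs_le ν hψ hC
  -- the logarithms of the exponential moments converge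
  have hlog : Tendsto (fun k => Real.log (∫ x, Real.exp (ψ x) ∂(R k))) atTop
      (𝓝 (Real.log (∫ x, Real.exp (ψ x) ∂ν))) := hR.log hZ.ne'
  refine le_of_forall_pos_le_add fun δ hδ => ?_
  -- frequently `KL(P_k ‖ R_k) < L + δ`
  have hlt : L < L + ENNReal.ofReal δ := ENNReal.lt_add_right hL (by simpa using hδ)
  have hfreq : ∃ᶠ k in atTop, klDiv (P k) (R k) < L + ENNReal.ofReal δ := frequently_lt_of_liminf_lt (by isBoundedDefault) hlt
  -- there, the finite-`k` Gibbs inequality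
  have hgibbs : ∃ᶠ k in atTop, ∫ x, ψ x ∂(P k) ≤ L.toReal + δ + Real.log (∫ x, Real.exp (ψ x) ∂(R k)) := by
    refine hfreq.mono fun k hk => ?_
    have hfin : klDiv (P k) (R k) ≠ ∞ := (hk.trans_le le_top).ne
    have h1 := integral_le_toReal_klDiv_add_log hfin hψ hC
    have h2 : (klDiv (P k) (R k)).toReal ≤ L.toReal + δ := by
      have := ENNReal.toReal_mono (ENNReal.add_ne_top.2 ⟨hL, ENNReal.ofReal_ne_top⟩) hk.le
      rwa [ENNReal.toReal_add hL ENNReal.ofReal_ne_top, ENNReal.toReal_ofReal hδ.le] at this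
    linarith
  -- pass to the limit: if the conclusion failed, it would fail eventually along `k`
  by_contra hcon
  push Not at hcon
  have hev : ∀ᶠ k in atTop, L.toReal + δ + Real.log (∫ x, Real.exp (ψ x) ∂(R k)) < ∫ x, ψ x ∂(P k) := by
    have hlim : Tendsto (fun k => ∫ x, ψ x ∂(P k) - Real.log (∫ x, Real.exp (ψ x) ∂(R k))) atTop
        (𝓝 (∫ x, ψ x ∂μ - Real.log (∫ x, Real.exp (ψ x) ∂ν))) := hP.sub hlog
    have hgt : L.toReal + δ < ∫ x, ψ x ∂μ - Real.log (∫ x, Real.exp (ψ x) ∂ν) := by linarith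
    filter_upwards [hlim.eventually (lt_mem_nhds hgt)] with k hk
    linarith
  obtain ⟨k, hk1, hk2⟩ := (hgibbs.and_eventually hev).exists
  linarith

/-! ## Donsker–Varadhan upper bound from a dense class of test functions -/

/-- **Donsker–Varadhan upper bound, tested on a dense class only.** Let `μ, ν` be probability laws and `𝓥` a class
of functions such that every measurable `ψ` with `|ψ| ≤ C` is, for every `ε > 0`, `ε`-close in `L¹(μ)` AND in `L¹(ν)`
to a measurable member of `𝓥` with the same bound `C`. If `∫ ψ dμ ≤ K + log ∫ e^ψ dν` for all bounded measurable
`ψ ∈ 𝓥`, then `KL(μ ‖ ν) ≤ K`. (Both sides of the Gibbs inequality are `L¹`-continuous on `{|ψ| ≤ C}`: the mean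
trivially, the exponential moment because `exp` is `e^C`-Lipschitz there and bounded below by `e^{-C} > 0`.) -/
theorem klDiv_le_ofReal_of_forall_mem {μ ν : Measure Ω} [IsProbabilityMeasure μ] [IsProbabilityMeasure ν]
    {K : ℝ} {𝓥 : Set (Ω → ℝ)}
    (hdense : ∀ (ψ : Ω → ℝ) (C : ℝ), Measurable ψ → (∀ x, |ψ x| ≤ C) → ∀ ε : ℝ, 0 < ε →
      ∃ ψ' ∈ 𝓥, Measurable ψ' ∧ (∀ x, |ψ' x| ≤ C) ∧ ∫ x, |ψ x - ψ' x| ∂μ ≤ ε ∧ ∫ x, |ψ x - ψ' x| ∂ν ≤ ε)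
    (h : ∀ ψ ∈ 𝓥, ∀ C : ℝ, Measurable ψ → (∀ x, |ψ x| ≤ C) →
      ∫ x, ψ x ∂μ ≤ K + Real.log (∫ x, Real.exp (ψ x) ∂ν)) :
    klDiv μ ν ≤ ENNReal.ofReal K := by
  refine klDiv_le_of_forall_integral_le fun ψ C hψ hC => ?_
  set Z := ∫ x, Real.exp (ψ x) ∂ν with hZdef
  have hZ : 0 < Z := integral_exp_pos_of_abs_le ν hψ hC
  -- for every `ε > 0`: `∫ ψ dμ ≤ K + log (Z + e^C ε) + ε`
  have hall : ∀ ε : ℝ, 0 < ε → ∫ x, ψ x ∂μ ≤ K + Real.log (Z + Real.exp C * ε) + ε := by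
    intro ε hε
    obtain ⟨ψ', hψ'𝓥, hψ'm, hC', hμ', hν'⟩ := hdense ψ C hψ hC ε hε
    have h1 := integral_le_integral_add_integral_abs_sub μ hψ hψ'm hC hC'
    have h2 := h ψ' hψ'𝓥 C hψ'm hC'
    have h3 := integral_exp_le_integral_exp_add ν hψ hψ'm hC hC'
    have hZ' : 0 < ∫ x, Real.exp (ψ' x) ∂ν := integral_exp_pos_of_abs_le ν hψ'm hC'
    have h4 : Real.log (∫ x, Real.exp (ψ' x) ∂ν) ≤ Real.log (Z + Real.exp C * ε) :=
      Real.log_le_log hZ' (h3.trans (by nlinarith [Real.exp_pos C]))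
    linarith
  -- let `ε → 0`
  have hlim : Tendsto (fun ε : ℝ => K + Real.log (Z + Real.exp C * ε) + ε) (𝓝[>] 0)
      (𝓝 (K + Real.log (Z + Real.exp C * 0) + 0)) := by
    refine ((tendsto_const_nhds.add ((tendsto_const_nhds.add (tendsto_const_nhds.mul
      tendsto_id)).log ?_)).add tendsto_id).mono_left nhdsWithin_le_nhds
    rw [mul_zero, add_zero]; exact hZ.ne'
  rw [mul_zero, add_zero, add_zero] at hlim
  exact ge_of_tendsto hlim (eventually_nhdsWithin_of_forall fun ε hε => hall ε hε)

/-! ## Joint lower semicontinuity along a dense class -/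

/-- **Lower semicontinuity of the Kullback–Leibler divergence along a dense test class** (registered helper stub of
line `FirstLemma`). On a measurable space let `P_k, R_k, μ, ν` be probability laws and `𝓥` a class of test
functions such that: `∫ ψ dP_k → ∫ ψ dμ` for `ψ ∈ 𝓥` (weak convergence ON `𝓥` ONLY — e.g. bounded vaguely
continuous cylinder functionals of a point process, from convergence of Laplace functionals);
`∫ e^ψ dR_k → ∫ e^ψ dν` for `ψ ∈ 𝓥` (e.g. setwise convergence of the references,
`tendsto_integral_of_forall_tendsto_measure`); and `𝓥` is dense in `L¹(μ) ∩ L¹(ν)` among the measurable functions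
with the same uniform bound. Then `KL(μ ‖ ν) ≤ liminf_k KL(P_k ‖ R_k)` — the Donsker–Varadhan supremum of `μ, ν`
is attained along `𝓥`, on which the finite-`k` Gibbs inequalities pass to the limit. -/
theorem stub_klDiv_lsc_of_denseClass {Ω : Type*} [MeasurableSpace Ω] {P R : ℕ → Measure Ω}
    [∀ k, IsProbabilityMeasure (P k)] [∀ k, IsProbabilityMeasure (R k)] {μ ν : Measure Ω}
    [IsProbabilityMeasure μ] [IsProbabilityMeasure ν] (𝓥 : Set (Ω → ℝ))
    (hP : ∀ ψ ∈ 𝓥, ∀ C : ℝ, Measurable ψ → (∀ x, |ψ x| ≤ C) →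
      Tendsto (fun k => ∫ x, ψ x ∂(P k)) atTop (𝓝 (∫ x, ψ x ∂μ)))
    (hR : ∀ ψ ∈ 𝓥, ∀ C : ℝ, Measurable ψ → (∀ x, |ψ x| ≤ C) →
      Tendsto (fun k => ∫ x, Real.exp (ψ x) ∂(R k)) atTop (𝓝 (∫ x, Real.exp (ψ x) ∂ν)))
    (hdense : ∀ (ψ : Ω → ℝ) (C : ℝ), Measurable ψ → (∀ x, |ψ x| ≤ C) → ∀ ε : ℝ, 0 < ε →
      ∃ ψ' ∈ 𝓥, Measurable ψ' ∧ (∀ x, |ψ' x| ≤ C) ∧ ∫ x, |ψ x - ψ' x| ∂μ ≤ ε ∧ ∫ x, |ψ x - ψ' x| ∂ν ≤ ε) :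
    klDiv μ ν ≤ liminf (fun k => klDiv (P k) (R k)) atTop := by
  by_cases hL : liminf (fun k => klDiv (P k) (R k)) atTop = ∞
  · rw [hL]; exact le_top
  rw [← ENNReal.ofReal_toReal hL]
  exact klDiv_le_ofReal_of_forall_mem hdense fun ψ hψ𝓥 C hψ hC =>
    integral_le_toReal_liminf_klDiv_add_log hψ hC (hP ψ hψ𝓥 C hψ hC) (hR ψ hψ𝓥 C hψ hC) hL

/-! ## Setwise convergent references -/

/-- **Setwise convergence gives convergence of bounded integrals.** If probability laws `R_k → ν` setwise
(`R_k A → ν A` for every measurable `A`), then `∫ ψ dR_k → ∫ ψ dν` for every measurable `ψ` with `|ψ| ≤ C`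
(layer-cake representation `∫ (ψ + C) dR = ∫₀^{2C} R(ψ + C > t) dt` and dominated convergence in `t`). -/
theorem tendsto_integral_of_forall_tendsto_measure {R : ℕ → Measure Ω} [∀ k, IsProbabilityMeasure (R k)]
    {ν : Measure Ω} [IsProbabilityMeasure ν]
    (h : ∀ A : Set Ω, MeasurableSet A → Tendsto (fun k => R k A) atTop (𝓝 (ν A)))
    {ψ : Ω → ℝ} (hψ : Measurable ψ) {C : ℝ} (hC : ∀ x, |ψ x| ≤ C) :
    Tendsto (fun k => ∫ x, ψ x ∂(R k)) atTop (𝓝 (∫ x, ψ x ∂ν)) := by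
  -- reduce to the nonnegative function `φ = ψ + C ∈ [0, 2C]`
  set φ : Ω → ℝ := fun x => ψ x + C with hφdef
  have hφm : Measurable φ := hψ.add_const C
  have hφ0 : ∀ x, 0 ≤ φ x := fun x => by have := (abs_le.1 (hC x)).1; show 0 ≤ ψ x + C; linarith
  have hφle : ∀ x, φ x ≤ 2 * C := fun x => by have := (abs_le.1 (hC x)).2; show ψ x + C ≤ 2 * C; linarith
  have hφi : ∀ (ρ : Measure Ω) [IsFiniteMeasure ρ], Integrable φ ρ := fun ρ _ =>
    Integrable.of_bound hφm.aestronglyMeasurable (2 * C) (ae_of_all _ fun x => by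
      rw [Real.norm_eq_abs, abs_of_nonneg (hφ0 x)]; exact hφle x)
  -- layer cake for every probability law
  have hcake : ∀ (ρ : Measure Ω) [IsProbabilityMeasure ρ],
      ∫ x, φ x ∂ρ = ∫ t in Ioi (0 : ℝ), ρ.real {x | t < φ x} := fun ρ _ =>
    (hφi ρ).integral_eq_integral_meas_lt (ae_of_all _ hφ0)
  -- dominated convergence in `t`
  have hlim : Tendsto (fun k => ∫ t in Ioi (0 : ℝ), (R k).real {x | t < φ x}) atTop
      (𝓝 (∫ t in Ioi (0 : ℝ), ν.real {x | t < φ x})) := by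
    refine tendsto_integral_of_dominated_convergence (fun t => (Ioc (0 : ℝ) (2 * C)).indicator (fun _ => (1 : ℝ)) t)
      (fun k => ?_) ?_ (fun k => ?_) ?_
    · -- measurability in `t`: `t ↦ R {t < φ}` is antitone
      have hanti : Antitone fun t : ℝ => (R k).real {x | t < φ x} := fun s t hst =>
        measureReal_mono (fun x (hx : t < φ x) => lt_of_le_of_lt hst hx)
      exact hanti.measurable.aestronglyMeasurable
    · rw [integrable_indicator_iff measurableSet_Ioc]
      refine integrableOn_const ?_
      rw [Measure.restrict_apply measurableSet_Ioc]
      exact ((measure_mono inter_subset_left).trans_lt measure_Ioc_lt_top).ne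
    · refine (ae_restrict_mem measurableSet_Ioi).mono fun t (ht : 0 < t) => ?_
      rw [Real.norm_eq_abs, abs_of_nonneg measureReal_nonneg]
      by_cases htC : t ≤ 2 * C
      · rw [indicator_of_mem (show t ∈ Ioc (0 : ℝ) (2 * C) from ⟨ht, htC⟩)]; exact measureReal_le_one
      · rw [indicator_of_notMem (fun h => htC h.2)]
        have hempty : {x | t < φ x} = ∅ := eq_empty_of_forall_notMem fun x (hx : t < φ x) =>
          htC ((hx.le).trans (hφle x))
        rw [hempty, measureReal_empty]
    · refine (ae_restrict_mem measurableSet_Ioi).mono fun t (_ : 0 < t) => ?_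
      have hA : MeasurableSet {x | t < φ x} := measurableSet_lt measurable_const hφm
      exact (ENNReal.tendsto_toReal (measure_ne_top ν _)).comp (h _ hA)
  -- back to `ψ`
  have hshift : ∀ (ρ : Measure Ω) [IsProbabilityMeasure ρ], ∫ x, ψ x ∂ρ = (∫ x, φ x ∂ρ) - C := fun ρ _ => by
    simp only [hφdef]
    rw [integral_add (integrable_of_abs_le' ρ hψ hC) (integrable_const C), integral_const, probReal_univ,
      one_smul, add_sub_cancel_right]
  simp only [hshift, hcake] at hlim ⊢
  exact hlim.sub_const C

/-- **Lower semicontinuity with a setwise convergent reference**: as `stub_klDiv_lsc_of_denseClass`, with the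
exponential-moment hypothesis on the references discharged by setwise convergence `R_k → ν`. -/
theorem klDiv_lsc_of_denseClass_of_setwise {P R : ℕ → Measure Ω} [∀ k, IsProbabilityMeasure (P k)]
    [∀ k, IsProbabilityMeasure (R k)] {μ ν : Measure Ω} [IsProbabilityMeasure μ] [IsProbabilityMeasure ν]
    (𝓥 : Set (Ω → ℝ))
    (hP : ∀ ψ ∈ 𝓥, ∀ C : ℝ, Measurable ψ → (∀ x, |ψ x| ≤ C) →
      Tendsto (fun k => ∫ x, ψ x ∂(P k)) atTop (𝓝 (∫ x, ψ x ∂μ)))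
    (hR : ∀ A : Set Ω, MeasurableSet A → Tendsto (fun k => R k A) atTop (𝓝 (ν A)))
    (hdense : ∀ (ψ : Ω → ℝ) (C : ℝ), Measurable ψ → (∀ x, |ψ x| ≤ C) → ∀ ε : ℝ, 0 < ε →
      ∃ ψ' ∈ 𝓥, Measurable ψ' ∧ (∀ x, |ψ' x| ≤ C) ∧ ∫ x, |ψ x - ψ' x| ∂μ ≤ ε ∧ ∫ x, |ψ x - ψ' x| ∂ν ≤ ε) :
    klDiv μ ν ≤ liminf (fun k => klDiv (P k) (R k)) atTop :=
  stub_klDiv_lsc_of_denseClass 𝓥 hP (fun ψ _ C hψ hC =>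
    tendsto_integral_of_forall_tendsto_measure hR hψ.exp (C := Real.exp C) fun x => by
      rw [abs_of_pos (Real.exp_pos _)]
      exact Real.exp_le_exp.2 ((le_abs_self _).trans (hC x))) hdense

/-! ## Data processing for push-forwards and windows -/

/-- **Data-processing inequality for push-forwards**: `KL(f_* μ ‖ f_* ν) ≤ KL(μ ‖ ν)` for probability laws and a
measurable map `f` (test `ψ ∘ f` in the Gibbs inequality of `(μ, ν)`, then the Donsker–Varadhan upper bound for
`(f_* μ, f_* ν)`). -/
theorem klDiv_map_le_klDiv {Ω' : Type*} [MeasurableSpace Ω'] (μ ν : Measure Ω) [IsProbabilityMeasure μ]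
    [IsProbabilityMeasure ν] {f : Ω → Ω'} (hf : Measurable f) :
    klDiv (μ.map f) (ν.map f) ≤ klDiv μ ν := by
  by_cases hfin : klDiv μ ν = ∞
  · rw [hfin]; exact le_top
  haveI : IsProbabilityMeasure (μ.map f) := Measure.isProbabilityMeasure_map hf.aemeasurable
  haveI : IsProbabilityMeasure (ν.map f) := Measure.isProbabilityMeasure_map hf.aemeasurable
  rw [← ENNReal.ofReal_toReal hfin]
  refine klDiv_le_of_forall_integral_le fun ψ C hψ hC => ?_
  rw [integral_map hf.aemeasurable hψ.aestronglyMeasurable,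
    integral_map hf.aemeasurable hψ.exp.aestronglyMeasurable]
  exact integral_le_toReal_klDiv_add_log hfin (hψ.comp hf) fun x => hC (f x)

section Window

open Literature.Analysis.FunctionSpaces (PointConfig)
open Literature.MathematicalPhysics.KineticTheory.PointProcess (windowRestrict windowLaw measurable_windowRestrict
  isProbabilityMeasure_windowLaw)

variable {d : Type*} {M : Type*} [TopologicalSpace M] [MeasurableSpace M]

omit [MeasurableSpace M] in
/-- Restricting to a sub-window after a window is restricting to the sub-window. -/
theorem windowRestrict_windowRestrict {Λ Λ' : Set (EuclideanSpace ℝ d)} (hΛ : Λ ⊆ Λ')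
    (ω : PointConfig (EuclideanSpace ℝ d × M)) : windowRestrict Λ (windowRestrict Λ' ω) = windowRestrict Λ ω := by
  ext p
  change p ∈ (ω.carrier ∩ Prod.fst ⁻¹' Λ') ∩ Prod.fst ⁻¹' Λ ↔ p ∈ ω.carrier ∩ Prod.fst ⁻¹' Λ
  exact ⟨fun hp => ⟨hp.1.1, hp.2⟩, fun hp => ⟨⟨hp.1, hΛ hp.2⟩, hp.2⟩⟩

/-- The law in a sub-window is the push-forward of the law in the window. -/
theorem windowLaw_eq_map_windowLaw {Λ Λ' : Set (EuclideanSpace ℝ d)} (hΛm : MeasurableSet Λ)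
    (hΛ'm : MeasurableSet Λ') (hΛ : Λ ⊆ Λ') (μ : Measure (PointConfig (EuclideanSpace ℝ d × M))) :
    windowLaw Λ μ = (windowLaw Λ' μ).map (windowRestrict Λ) := by
  rw [windowLaw, windowLaw, Measure.map_map (measurable_windowRestrict hΛm) (measurable_windowRestrict hΛ'm)]
  congr 1
  exact funext fun ω => (windowRestrict_windowRestrict hΛ ω).symm

/-- **Entropy of a sub-window is smaller**: for measurable windows `Λ ⊆ Λ'` and probability laws `μ, G`,
`KL(μ_Λ ‖ G_Λ) ≤ KL(μ_Λ' ‖ G_Λ')` (data processing along the restriction `Λ' → Λ`). -/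
theorem klDiv_windowLaw_mono {Λ Λ' : Set (EuclideanSpace ℝ d)} (hΛm : MeasurableSet Λ) (hΛ'm : MeasurableSet Λ')
    (hΛ : Λ ⊆ Λ') (μ G : Measure (PointConfig (EuclideanSpace ℝ d × M))) [IsProbabilityMeasure μ]
    [IsProbabilityMeasure G] :
    klDiv (windowLaw Λ μ) (windowLaw Λ G) ≤ klDiv (windowLaw Λ' μ) (windowLaw Λ' G) := by
  haveI := isProbabilityMeasure_windowLaw (M := M) hΛ'm μ
  haveI := isProbabilityMeasure_windowLaw (M := M) hΛ'm G
  rw [windowLaw_eq_map_windowLaw hΛm hΛ'm hΛ μ, windowLaw_eq_map_windowLaw hΛm hΛ'm hΛ G]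
  exact klDiv_map_le_klDiv _ _ (measurable_windowRestrict hΛm)

end Window

end Summit.AtomisticToContinuum.HydrodynamicLimit.Theorems.KiferCompactification

end
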